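import Summits.AtomisticToContinuum.HydrodynamicLimit.Theorems.TwoClocksEquilibriumFastWindowLDBirthT12LorentzAngular
import Summits.AtomisticToContinuum.HydrodynamicLimit.Theorems.TwoClocksEquilibriumFastWindowLDBirthT12GainRadialB
import Literature.Probability.Distributions.GaussianMoments
import HarnessLib

/-!
# (e-K₂) for GENERAL radial test functions, I: the exact one-dimensional (Carleman slice)
# representation of the true gain term on `G ∘ ‖·‖` and of its Lorentz limit
# (helper `t12_gainTerm_radial_slice` of the line `birth`, crux `TwoClocks.EquilibriumFastWindowLD`,
# stmt-AtomisticToContinuum-14440; infrastructure (e-K₂), `ℓ = 0`, towards the registered analytic sub-goal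
# `t12_logLinearPreimage_and_dipoleModulus`, plan §5)

Companion of `…T12GainRadial` / `…T12GainRadialB` (the law comparison `gainTerm (G ∘ ‖·‖) v` versus
`lorentzGain (G ∘ ‖·‖) v` for indicators, radial step functions, the weights `1`, `‖x‖`). The (e-K₂) step
of the corrector analysis needs it for `G` merely measurable of linear growth, where no modulus of
continuity is available and only a comparison of the two LAWS of the outgoing speed can work. This file
reduces both laws to ONE explicit formula.

* **Exchange symmetry** (`gainFst_eq_gainSnd`, `…T12LorentzAngular`): the own and the partner outgoing
  velocities have the same flux law for every partner `w`, so `gainTerm ψ v = 2 ∫ dM(w) ∫ (u·ω)₊ ψ(v') dσ`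
  — it suffices to follow the OWN particle `v' = v - ((v - w)·ω) ω`.
* **Carleman's slice** (`hardSphereKernel_mul_comp_norm_collide_fst`): with `a = ⟪v, ω⟫`, `t = ⟪w, ω⟫`,
  `(u·ω)₊ = (a - t)₊` and `‖v'‖² = ‖v‖² - a² + t²` — the own outgoing SPEED sees the partner only through
  the one-dimensional projection `t = ⟪w, ω⟫`, which under the Maxwellian `M = stdGaussian` is a standard
  real Gaussian `γ = gaussianReal 0 1` for every direction `ω` (`stdGaussian_map_inner_sphere`, Mathlib's
  `IsGaussian.map_eq_gaussianReal`).
* **Hat-box** (`integral_sphere_comp_inner_real`, `…T12Angular`): `a = ‖v‖ x` with `x` uniform on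
  `[-1, 1]`, weight `2π`.

Whence the registered **`t12_gainTerm_radial_slice`**: for `G` measurable with `|G t| ≤ m (1 + t)` on
`[0, ∞)` and every `v`, `S = ‖v‖`,

  `gainTerm (G ∘ ‖·‖) v = 4π ∫ γ(dt) J(t)`,  `J(t) := ∫_{-1}^{1} (S x - t)₊ G(√(S² - (S x)² + t²)) dx`

(the RADIAL SLICE functional: the flux-weighted circle average of `G(‖v'‖)` over the impact directions of
height `x = ⟪v̂, ω⟫` when the partner has projection `t`), and (`lorentzGain_radial_eq_slice`)
**`lorentzGain (G ∘ ‖·‖) v = 4π J(0) = 4π ∫_{-1}^{1} (S x)₊ G(√(S² - (S x)²)) dx`**: the Lorentz operator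
(partner frozen at rest, `…T12Lorentz`) IS the slice `t = 0`, and the true gain term is its Gaussian average
over the thermal projection `t = ⟪w, ω⟫ ∼ γ`. The (e-K₂) comparison for rough `G` is thereby the
one-dimensional estimate `∫ γ(dt) |J(t) - J(0)| = O(m (1 + S))`, carried out in the sibling file
`…T12GainRadialGeneralB` (substitution `y = S² - (S x)² + t²`, `(S x)₊ dx = -dy/(2S)`:
`∫₀¹ S x G(√(S²(1 - x²) + t²)) dx = (2S)⁻¹ ∫_{t²}^{S² + t²} G(√y) dy`, an `O(t²)`-displacement of the window
`[0, S²]` — no regularity of `G` is involved).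

[folklore] (Carleman's representation of the hard-sphere gain term, Carleman 1933 / Hilbert 1912;
Cercignani–Illner–Pulvirenti 1994 §7.2; Grad 1963 §4 for the far-field limit; (e-K₂) of the
corrector-growth plan of the line `birth`).
-/

noncomputable section

open MeasureTheory ProbabilityTheory Real Set Filter Metric
open scoped ENNReal BigOperators InnerProductSpace
namespace Summit.AtomisticToContinuum.HydrodynamicLimit.Theorems.ClampedCorrectorBirth

open Literature.Analysis.FluidPDE Literature.MathematicalPhysics.KineticTheory
open Literature.Analysis.UnboundedOperators Literature.Probability.Distributions

variable {G : ℝ → ℝ} {m : ℝ} {v : EuclideanSpace ℝ (Fin 3)}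

/-! ### Carleman's slice of one collision and the Gaussian projection -/

/-- **Carleman's slice of the own particle**: with `a = ⟪v, ω⟫`, `t = ⟪w, ω⟫`,
`((v - w)·ω)₊ G(‖v'‖) = (a - t)₊ G(√(‖v‖² - a² + t²))` — the own outgoing speed `‖v - (a - t) ω‖` sees the
partner only through its projection `t` on the impact direction. [folklore] -/
theorem hardSphereKernel_mul_comp_norm_collide_fst (G : ℝ → ℝ) (v w : EuclideanSpace ℝ (Fin 3))
    (ω : sphere (0 : EuclideanSpace ℝ (Fin 3)) 1) :
    hardSphereKernel (v, w) ω * G ‖(collide ω (v, w)).1‖ =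
      max (⟪v, (ω : EuclideanSpace ℝ (Fin 3))⟫_ℝ - ⟪w, (ω : EuclideanSpace ℝ (Fin 3))⟫_ℝ) 0 *
        G (√(‖v‖ ^ 2 - ⟪v, (ω : EuclideanSpace ℝ (Fin 3))⟫_ℝ ^ 2 + ⟪w, (ω : EuclideanSpace ℝ (Fin 3))⟫_ℝ ^ 2)) := by
  have hsq : ‖(collide ω (v, w)).1‖ ^ 2 =
      ‖v‖ ^ 2 - ⟪v, (ω : EuclideanSpace ℝ (Fin 3))⟫_ℝ ^ 2 + ⟪w, (ω : EuclideanSpace ℝ (Fin 3))⟫_ℝ ^ 2 := by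
    simp only [collide]
    rw [norm_sub_sq_real, real_inner_smul_right, norm_smul, norm_eq_of_mem_sphere, mul_one, Real.norm_eq_abs,
      sq_abs, inner_sub_left]
    ring
  have h1 : ‖(collide ω (v, w)).1‖ =
      √(‖v‖ ^ 2 - ⟪v, (ω : EuclideanSpace ℝ (Fin 3))⟫_ℝ ^ 2 + ⟪w, (ω : EuclideanSpace ℝ (Fin 3))⟫_ℝ ^ 2) := by
    rw [← hsq, Real.sqrt_sq (norm_nonneg _)]
  have h2 : hardSphereKernel (v, w) ω =
      max (⟪v, (ω : EuclideanSpace ℝ (Fin 3))⟫_ℝ - ⟪w, (ω : EuclideanSpace ℝ (Fin 3))⟫_ℝ) 0 := by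
    simp only [hardSphereKernel, inner_sub_left]
  rw [h1, h2]

/-- Every `v` is `‖v‖` times a unit vector, as seen by all linear functionals `⟪·, x⟫`. [folklore] -/
theorem exists_unit_inner_eq (v : EuclideanSpace ℝ (Fin 3)) :
    ∃ n : EuclideanSpace ℝ (Fin 3), ‖n‖ = 1 ∧ ∀ x : EuclideanSpace ℝ (Fin 3), ⟪v, x⟫_ℝ = ‖v‖ * ⟪n, x⟫_ℝ := by
  rcases eq_or_ne v 0 with rfl | hv
  · exact ⟨EuclideanSpace.single 0 1, by simp, fun x => by simp⟩
  · refine ⟨‖v‖⁻¹ • v, norm_smul_inv_norm hv, fun x => ?_⟩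
    rw [real_inner_smul_left, ← mul_assoc, mul_inv_cancel₀ (norm_ne_zero_iff.2 hv), one_mul]

/-- **The Maxwellian projection on a direction is a standard real Gaussian**: for `ω ∈ S²`, the image of
`M = stdGaussian ℝ³` under `w ↦ ⟪w, ω⟫` is `γ = gaussianReal 0 1` (Mathlib's `IsGaussian.map_eq_gaussianReal`
for the functional `innerSL ℝ ω` of norm `1`). [folklore] -/
theorem stdGaussian_map_inner_sphere (ω : sphere (0 : EuclideanSpace ℝ (Fin 3)) 1) :
    (stdGaussian (EuclideanSpace ℝ (Fin 3))).map
        (fun w : EuclideanSpace ℝ (Fin 3) => ⟪w, (ω : EuclideanSpace ℝ (Fin 3))⟫_ℝ) = gaussianReal 0 1 := by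
  have h : (fun w : EuclideanSpace ℝ (Fin 3) => ⟪w, (ω : EuclideanSpace ℝ (Fin 3))⟫_ℝ) =
      ⇑(innerSL ℝ (ω : EuclideanSpace ℝ (Fin 3))) := by
    funext w
    rw [innerSL_apply_apply, real_inner_comm]
  rw [h, IsGaussian.map_eq_gaussianReal, integral_strongDual_stdGaussian, variance_dual_stdGaussian,
    innerSL_apply_norm, norm_eq_of_mem_sphere, one_pow, Real.toNNReal_one]

/-- **Gaussian projection, Bochner form**: `∫ h(⟪w, ω⟫) dM(w) = ∫ h dγ` for every measurable `h : ℝ → ℝ`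
and `ω ∈ S²` (no integrability needed). [folklore] -/
theorem integral_stdGaussian_comp_inner_sphere (ω : sphere (0 : EuclideanSpace ℝ (Fin 3)) 1) {h : ℝ → ℝ}
    (hh : Measurable h) :
    ∫ w, h ⟪w, (ω : EuclideanSpace ℝ (Fin 3))⟫_ℝ ∂stdGaussian (EuclideanSpace ℝ (Fin 3)) = ∫ t, h t ∂gaussianReal 0 1 := by
  rw [← stdGaussian_map_inner_sphere ω, integral_map (by fun_prop) hh.aestronglyMeasurable]

/-! ### The slice on the sphere: hat-box -/

/-- **The `t`-slice on the sphere is `2π J(t)`**: for unit `n` with `⟪v, ·⟫ = ‖v‖ ⟪n, ·⟫` and every `t`,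
`∫_{S²} (⟪v, ω⟫ - t)₊ G(√(‖v‖² - ⟪v, ω⟫² + t²)) dσ(ω) = 2π ∫_{-1}^{1} (‖v‖ x - t)₊ G(√(‖v‖² - (‖v‖ x)² + t²)) dx`
(hat-box law in the height `x = ⟪n, ω⟫`). [folklore] -/
theorem sphereIntegral_slice_eq (hG : Measurable G) {n : EuclideanSpace ℝ (Fin 3)} (hn : ‖n‖ = 1)
    (hvn : ∀ x : EuclideanSpace ℝ (Fin 3), ⟪v, x⟫_ℝ = ‖v‖ * ⟪n, x⟫_ℝ) (t : ℝ) :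
    ∫ ω : sphere (0 : EuclideanSpace ℝ (Fin 3)) 1,
        max (⟪v, (ω : EuclideanSpace ℝ (Fin 3))⟫_ℝ - t) 0 *
          G (√(‖v‖ ^ 2 - ⟪v, (ω : EuclideanSpace ℝ (Fin 3))⟫_ℝ ^ 2 + t ^ 2)) ∂sphereMeasure =
      2 * π * ∫ x in (-1:ℝ)..1, max (‖v‖ * x - t) 0 * G (√(‖v‖ ^ 2 - (‖v‖ * x) ^ 2 + t ^ 2)) := by
  have hg : AEStronglyMeasurable
      (fun x : ℝ => max (‖v‖ * x - t) 0 * G (√(‖v‖ ^ 2 - (‖v‖ * x) ^ 2 + t ^ 2)))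
      (volume.restrict (Icc (-1:ℝ) 1)) := by
    refine Measurable.aestronglyMeasurable ?_
    fun_prop
  simp_rw [hvn]
  exact integral_sphere_comp_inner_real hn hg

/-! ### Integrability on the two product spaces -/

/-- Linear growth `|G t| ≤ m (1 + t)` on `[0, ∞)` forces `0 ≤ m`. [folklore] -/
theorem nonneg_of_linearGrowth (hm : ∀ t : ℝ, 0 ≤ t → |G t| ≤ m * (1 + t)) : 0 ≤ m :=
  (abs_nonneg _).trans ((hm 0 le_rfl).trans_eq (by ring))

/-- A measurable function bounded on `uIoc a b` is interval integrable. [folklore] -/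
theorem intervalIntegrable_of_abs_le {f : ℝ → ℝ} (hf : Measurable f) {a b C : ℝ} (h : ∀ x ∈ uIoc a b, |f x| ≤ C) :
    IntervalIntegrable f volume a b :=
  intervalIntegrable_const.mono_fun' hf.aestronglyMeasurable
    ((ae_restrict_iff' measurableSet_uIoc).2 (Eventually.of_forall fun x hx =>
      (Real.norm_eq_abs _).trans_le (h x hx)))

/-- `y ↦ G(√y)` is interval integrable on every `[a, b]` for `G` measurable of linear growth
(`|G(√y)| ≤ m (1 + √(|a| + |b|))` there). [folklore] -/
theorem intervalIntegrable_comp_sqrt (hG : Measurable G) (hm : ∀ t : ℝ, 0 ≤ t → |G t| ≤ m * (1 + t)) (a b : ℝ) :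
    IntervalIntegrable (fun y => G (√y)) volume a b := by
  have hm0 := nonneg_of_linearGrowth hm
  refine intervalIntegrable_of_abs_le (by fun_prop) (C := m * (1 + √(|a| + |b|))) fun y hy => ?_
  have hy' : y ≤ |a| + |b| := by
    rcases mem_uIoc.1 hy with h | h
    · exact h.2.trans ((le_abs_self b).trans (by linarith [abs_nonneg a]))
    · exact h.2.trans ((le_abs_self a).trans (by linarith [abs_nonneg b]))
  exact (hm _ (sqrt_nonneg y)).trans (by gcongr)

/-- `√(S² - a² + t²) ≤ S + |t|` for `0 ≤ S`. [folklore] -/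
theorem sqrt_sq_sub_sq_add_sq_le {S : ℝ} (hS : 0 ≤ S) (a t : ℝ) : √(S ^ 2 - a ^ 2 + t ^ 2) ≤ S + |t| := by
  rw [Real.sqrt_le_iff]
  refine ⟨by positivity, ?_⟩
  nlinarith [sq_nonneg a, abs_nonneg t, sq_abs t, mul_nonneg hS (abs_nonneg t)]

/-- **The slice integrand is dominated**: `|(a - t)₊ G(√(S² - a² + t²))| ≤ 2m(1 + S)² + 2m t²` for `|a| ≤ S`
(`(a - t)₊ ≤ S + |t|`, `|G| ≤ m(1 + S + |t|)`). [folklore] -/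
theorem abs_slice_integrand_le (hm : ∀ t : ℝ, 0 ≤ t → |G t| ≤ m * (1 + t)) {S a : ℝ} (hS : 0 ≤ S)
    (ha : |a| ≤ S) (t : ℝ) :
    |max (a - t) 0 * G (√(S ^ 2 - a ^ 2 + t ^ 2))| ≤ 2 * m * (1 + S) ^ 2 + 2 * m * t ^ 2 := by
  have hm0 := nonneg_of_linearGrowth hm
  have h1 : max (a - t) 0 ≤ S + |t| :=
    max_le (by linarith [le_abs_self a, neg_abs_le t]) (by positivity)
  have h2 : |G (√(S ^ 2 - a ^ 2 + t ^ 2))| ≤ m * (1 + (S + |t|)) :=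
    (hm _ (Real.sqrt_nonneg _)).trans (by gcongr; exact sqrt_sq_sub_sq_add_sq_le hS a t)
  rw [abs_mul, abs_of_nonneg (le_max_right _ _)]
  calc max (a - t) 0 * |G (√(S ^ 2 - a ^ 2 + t ^ 2))| ≤ (S + |t|) * (m * (1 + (S + |t|))) :=
        mul_le_mul h1 h2 (abs_nonneg _) (by positivity)
    _ ≤ 2 * m * (1 + S) ^ 2 + 2 * m * t ^ 2 := by
        nlinarith [mul_nonneg hm0 (by positivity : (0:ℝ) ≤ 1 + S + |t|), mul_nonneg hm0 (sq_nonneg (1 + S - |t|)),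
          sq_abs t]

/-- **Integrability of the own-particle integrand on `M ⊗ σ`**: `(w, ω) ↦ ((v - w)·ω)₊ G(‖v'‖)` is integrable for
`G` measurable of linear growth (dominated by `2m(1 + ‖v‖)² + 2m‖w‖²`). [folklore] -/
theorem integrable_gainFst_radial_prod (hG : Measurable G) (hm : ∀ t : ℝ, 0 ≤ t → |G t| ≤ m * (1 + t))
    (v : EuclideanSpace ℝ (Fin 3)) :
    Integrable (Function.uncurry fun (w : EuclideanSpace ℝ (Fin 3)) (ω : sphere (0 : EuclideanSpace ℝ (Fin 3)) 1) =>
        hardSphereKernel (v, w) ω * G ‖(collide ω (v, w)).1‖)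
      ((stdGaussian (EuclideanSpace ℝ (Fin 3))).prod (sphereMeasure : Measure (sphere (0 : EuclideanSpace ℝ (Fin 3)) 1))) := by
  haveI := isFiniteMeasure_sphereMeasure (E := EuclideanSpace ℝ (Fin 3))
  have hm0 := nonneg_of_linearGrowth hm
  have hsq : Integrable (fun w : EuclideanSpace ℝ (Fin 3) => ‖w‖ ^ 2) (stdGaussian (EuclideanSpace ℝ (Fin 3))) :=
    (IsGaussian.memLp_id (stdGaussian (EuclideanSpace ℝ (Fin 3))) 2 (by simp)).integrable_norm_pow (by norm_num)
  have hφ : Integrable (fun w : EuclideanSpace ℝ (Fin 3) => 2 * m * (1 + ‖v‖) ^ 2 + 2 * m * ‖w‖ ^ 2)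
      (stdGaussian (EuclideanSpace ℝ (Fin 3))) := (integrable_const _).add (hsq.const_mul _)
  have hB : Continuous fun p : EuclideanSpace ℝ (Fin 3) × sphere (0 : EuclideanSpace ℝ (Fin 3)) 1 =>
      hardSphereKernel (v, p.1) p.2 := by
    unfold hardSphereKernel; fun_prop
  have hC : Continuous fun p : EuclideanSpace ℝ (Fin 3) × sphere (0 : EuclideanSpace ℝ (Fin 3)) 1 =>
      (collide p.2 (v, p.1)).1 := by
    unfold collide; fun_prop
  refine (hφ.mul_prod (integrable_const (1:ℝ))).mono'
    (hB.measurable.mul (hG.comp hC.norm.measurable)).aestronglyMeasurable (Eventually.of_forall fun p => ?_)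
  rcases p with ⟨w, ω⟩
  simp only [Function.uncurry_apply_pair, mul_one, Real.norm_eq_abs]
  have ha : |⟪v, (ω : EuclideanSpace ℝ (Fin 3))⟫_ℝ| ≤ ‖v‖ := by
    have h := abs_real_inner_le_norm v (ω : EuclideanSpace ℝ (Fin 3))
    rwa [norm_eq_of_mem_sphere, mul_one] at h
  have ht : |⟪w, (ω : EuclideanSpace ℝ (Fin 3))⟫_ℝ| ≤ ‖w‖ := by
    have h := abs_real_inner_le_norm w (ω : EuclideanSpace ℝ (Fin 3))
    rwa [norm_eq_of_mem_sphere, mul_one] at h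
  rw [hardSphereKernel_mul_comp_norm_collide_fst]
  refine (abs_slice_integrand_le hm (norm_nonneg v) ha _).trans ?_
  have h2 : ⟪w, (ω : EuclideanSpace ℝ (Fin 3))⟫_ℝ ^ 2 ≤ ‖w‖ ^ 2 := by
    nlinarith [abs_nonneg ⟪w, (ω : EuclideanSpace ℝ (Fin 3))⟫_ℝ, sq_abs ⟪w, (ω : EuclideanSpace ℝ (Fin 3))⟫_ℝ]
  nlinarith [mul_le_mul_of_nonneg_left h2 hm0]

/-- **Integrability of the slice integrand on `σ ⊗ γ`**: `(ω, t) ↦ (⟪v, ω⟫ - t)₊ G(√(‖v‖² - ⟪v, ω⟫² + t²))` is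
integrable for `G` measurable of linear growth (dominated by `2m(1 + ‖v‖)² + 2m t²`, all Gaussian moments
being finite). [folklore] -/
theorem integrable_slice_prod (hG : Measurable G) (hm : ∀ t : ℝ, 0 ≤ t → |G t| ≤ m * (1 + t))
    (v : EuclideanSpace ℝ (Fin 3)) :
    Integrable (Function.uncurry fun (ω : sphere (0 : EuclideanSpace ℝ (Fin 3)) 1) (t : ℝ) =>
        max (⟪v, (ω : EuclideanSpace ℝ (Fin 3))⟫_ℝ - t) 0 *
          G (√(‖v‖ ^ 2 - ⟪v, (ω : EuclideanSpace ℝ (Fin 3))⟫_ℝ ^ 2 + t ^ 2)))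
      ((sphereMeasure : Measure (sphere (0 : EuclideanSpace ℝ (Fin 3)) 1)).prod (gaussianReal 0 1)) := by
  haveI := isFiniteMeasure_sphereMeasure (E := EuclideanSpace ℝ (Fin 3))
  have hψ : Integrable (fun t : ℝ => 2 * m * (1 + ‖v‖) ^ 2 + 2 * m * t ^ 2) (gaussianReal 0 1) :=
    (integrable_const _).add ((integrable_pow_gaussianReal 0 1 2).const_mul _)
  have hmeas : Measurable (Function.uncurry fun (ω : sphere (0 : EuclideanSpace ℝ (Fin 3)) 1) (t : ℝ) =>
      max (⟪v, (ω : EuclideanSpace ℝ (Fin 3))⟫_ℝ - t) 0 *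
        G (√(‖v‖ ^ 2 - ⟪v, (ω : EuclideanSpace ℝ (Fin 3))⟫_ℝ ^ 2 + t ^ 2))) := by
    refine Measurable.mul (by fun_prop) (hG.comp ?_)
    fun_prop
  refine ((integrable_const (1:ℝ)).mul_prod hψ).mono' hmeas.aestronglyMeasurable (Eventually.of_forall fun p => ?_)
  rcases p with ⟨ω, t⟩
  simp only [Function.uncurry_apply_pair, one_mul, Real.norm_eq_abs]
  have ha : |⟪v, (ω : EuclideanSpace ℝ (Fin 3))⟫_ℝ| ≤ ‖v‖ := by
    have h := abs_real_inner_le_norm v (ω : EuclideanSpace ℝ (Fin 3))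
    rwa [norm_eq_of_mem_sphere, mul_one] at h
  exact abs_slice_integrand_le hm (norm_nonneg v) ha t

/-! ### The exact slice representation of the own piece, of the gain term and of the Lorentz operator -/

/-- **The own piece in slice form**: for `G` measurable of linear growth,
`∫ dM(w) ∫_{S²} ((v - w)·ω)₊ G(‖v'‖) dσ(ω) = 2π ∫ J(t) dγ(t)` (Fubini on `M ⊗ σ`, the Gaussian projection
`t = ⟪w, ω⟫ ∼ γ`, Fubini on `σ ⊗ γ`, hat-box). [folklore] -/
theorem gainFst_radial_eq_slice (hG : Measurable G) (hm : ∀ t : ℝ, 0 ≤ t → |G t| ≤ m * (1 + t))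
    (v : EuclideanSpace ℝ (Fin 3)) :
    ∫ w, ∫ ω, hardSphereKernel (v, w) ω * G ‖(collide ω (v, w)).1‖ ∂sphereMeasure
        ∂stdGaussian (EuclideanSpace ℝ (Fin 3)) =
      2 * π * ∫ t, (∫ x in (-1:ℝ)..1, max (‖v‖ * x - t) 0 * G (√(‖v‖ ^ 2 - (‖v‖ * x) ^ 2 + t ^ 2))) ∂gaussianReal 0 1 := by
  haveI := isFiniteMeasure_sphereMeasure (E := EuclideanSpace ℝ (Fin 3))
  obtain ⟨n, hn, hvn⟩ := exists_unit_inner_eq v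
  have h1 := integrable_gainFst_radial_prod hG hm v
  have h2 := integrable_slice_prod hG hm v
  calc ∫ w, ∫ ω, hardSphereKernel (v, w) ω * G ‖(collide ω (v, w)).1‖ ∂sphereMeasure
          ∂stdGaussian (EuclideanSpace ℝ (Fin 3))
      = ∫ ω, ∫ w, hardSphereKernel (v, w) ω * G ‖(collide ω (v, w)).1‖ ∂stdGaussian (EuclideanSpace ℝ (Fin 3))
          ∂sphereMeasure := integral_integral_swap h1
    _ = ∫ ω : sphere (0 : EuclideanSpace ℝ (Fin 3)) 1, ∫ t,
          max (⟪v, (ω : EuclideanSpace ℝ (Fin 3))⟫_ℝ - t) 0 *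
            G (√(‖v‖ ^ 2 - ⟪v, (ω : EuclideanSpace ℝ (Fin 3))⟫_ℝ ^ 2 + t ^ 2)) ∂gaussianReal 0 1 ∂sphereMeasure := by
        refine integral_congr_ae (Eventually.of_forall fun ω => ?_)
        dsimp only
        simp_rw [hardSphereKernel_mul_comp_norm_collide_fst]
        exact integral_stdGaussian_comp_inner_sphere ω
          (h := fun t => max (⟪v, (ω : EuclideanSpace ℝ (Fin 3))⟫_ℝ - t) 0 *
            G (√(‖v‖ ^ 2 - ⟪v, (ω : EuclideanSpace ℝ (Fin 3))⟫_ℝ ^ 2 + t ^ 2))) (by fun_prop)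
    _ = ∫ t, ∫ ω : sphere (0 : EuclideanSpace ℝ (Fin 3)) 1,
          max (⟪v, (ω : EuclideanSpace ℝ (Fin 3))⟫_ℝ - t) 0 *
            G (√(‖v‖ ^ 2 - ⟪v, (ω : EuclideanSpace ℝ (Fin 3))⟫_ℝ ^ 2 + t ^ 2)) ∂sphereMeasure ∂gaussianReal 0 1 :=
        integral_integral_swap h2
    _ = ∫ t, 2 * π * (∫ x in (-1:ℝ)..1, max (‖v‖ * x - t) 0 * G (√(‖v‖ ^ 2 - (‖v‖ * x) ^ 2 + t ^ 2))) ∂gaussianReal 0 1 :=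
        integral_congr_ae (Eventually.of_forall fun t => sphereIntegral_slice_eq hG hn hvn t)
    _ = 2 * π * ∫ t, (∫ x in (-1:ℝ)..1, max (‖v‖ * x - t) 0 * G (√(‖v‖ ^ 2 - (‖v‖ * x) ^ 2 + t ^ 2))) ∂gaussianReal 0 1 := integral_const_mul _ _

/-- **The radial slice is `γ`-integrable** (`t ↦ J(t) ∈ L¹(γ)`), for `G` measurable of linear growth.
[folklore] -/
theorem integrable_slice (hG : Measurable G) (hm : ∀ t : ℝ, 0 ≤ t → |G t| ≤ m * (1 + t))
    (v : EuclideanSpace ℝ (Fin 3)) :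
    Integrable (fun t => ∫ x in (-1:ℝ)..1, max (‖v‖ * x - t) 0 * G (√(‖v‖ ^ 2 - (‖v‖ * x) ^ 2 + t ^ 2))) (gaussianReal 0 1) := by
  haveI := isFiniteMeasure_sphereMeasure (E := EuclideanSpace ℝ (Fin 3))
  obtain ⟨n, hn, hvn⟩ := exists_unit_inner_eq v
  have h := ((integrable_slice_prod hG hm v).integral_prod_right).congr
    (Eventually.of_forall fun t => sphereIntegral_slice_eq hG hn hvn t)
  refine (h.const_mul (2 * π)⁻¹).congr (Eventually.of_forall fun t => ?_)
  dsimp only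
  rw [← mul_assoc, inv_mul_cancel₀ (by positivity), one_mul]

/-- **The true gain term on radial functions in slice form**: for `G` measurable of linear growth,
`gainTerm (G ∘ ‖·‖) v = 4π ∫ J(t) dγ(t)` (exchange symmetry: twice the own piece). [folklore] -/
theorem gainTerm_radial_eq_slice (hG : Measurable G) (hm : ∀ t : ℝ, 0 ≤ t → |G t| ≤ m * (1 + t))
    (v : EuclideanSpace ℝ (Fin 3)) :
    gainTerm (fun x => G ‖x‖) v = 4 * π * ∫ t, (∫ x in (-1:ℝ)..1, max (‖v‖ * x - t) 0 * G (√(‖v‖ ^ 2 - (‖v‖ * x) ^ 2 + t ^ 2))) ∂gaussianReal 0 1 := by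
  have hu : Measurable fun x : EuclideanSpace ℝ (Fin 3) => G ‖x‖ := hG.comp measurable_norm
  have h2 : ∫ w, ∫ ω, hardSphereKernel (v, w) ω * G ‖(collide ω (v, w)).2‖ ∂sphereMeasure
        ∂stdGaussian (EuclideanSpace ℝ (Fin 3)) =
      ∫ w, ∫ ω, hardSphereKernel (v, w) ω * G ‖(collide ω (v, w)).1‖ ∂sphereMeasure
        ∂stdGaussian (EuclideanSpace ℝ (Fin 3)) :=
    integral_congr_ae (Eventually.of_forall fun w => (gainFst_eq_gainSnd v w hu).symm)
  simp only [gainTerm]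
  rw [h2, gainFst_radial_eq_slice hG hm v]
  ring

/-- **The Lorentz operator on radial functions is the slice `t = 0`**: for every measurable `G`,
`lorentzGain (G ∘ ‖·‖) v = 4π J(0) = 4π ∫_{-1}^{1} (‖v‖ x)₊ G(√(‖v‖² - (‖v‖ x)²)) dx` (partner at rest:
`t = ⟪0, ω⟫ = 0`). [folklore] -/
theorem lorentzGain_radial_eq_slice (hG : Measurable G) (v : EuclideanSpace ℝ (Fin 3)) :
    lorentzGain (fun x => G ‖x‖) v = 4 * π * ∫ x in (-1:ℝ)..1, max (‖v‖ * x) 0 * G (√(‖v‖ ^ 2 - (‖v‖ * x) ^ 2)) := by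
  have hu : Measurable fun x : EuclideanSpace ℝ (Fin 3) => G ‖x‖ := hG.comp measurable_norm
  obtain ⟨n, hn, hvn⟩ := exists_unit_inner_eq v
  have h0 := gain_zero_eq_lorentzGain v hu
  have h1 := gainFst_eq_gainSnd v 0 hu
  have h3 : ∫ ω, hardSphereKernel (v, 0) ω * G ‖(collide ω (v, 0)).1‖ ∂sphereMeasure =
      2 * π * ∫ x in (-1:ℝ)..1, max (‖v‖ * x - 0) 0 * G (√(‖v‖ ^ 2 - (‖v‖ * x) ^ 2 + 0 ^ 2)) := by
    rw [← sphereIntegral_slice_eq hG hn hvn 0]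
    refine integral_congr_ae (Eventually.of_forall fun ω => ?_)
    dsimp only
    rw [hardSphereKernel_mul_comp_norm_collide_fst, inner_zero_left]
  have h4 : (∫ x in (-1:ℝ)..1, max (‖v‖ * x - 0) 0 * G (√(‖v‖ ^ 2 - (‖v‖ * x) ^ 2 + 0 ^ 2))) = ∫ x in (-1:ℝ)..1, max (‖v‖ * x) 0 * G (√(‖v‖ ^ 2 - (‖v‖ * x) ^ 2)) := by
    simp only [sub_zero, ne_eq, OfNat.ofNat_ne_zero, not_false_eq_true, zero_pow, add_zero]
  rw [h4] at h3
  simp only at h0 h1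
  linarith

/-- **The (e-K₂) difference in slice form**: for `G` measurable of linear growth,
`gainTerm (G ∘ ‖·‖) v - lorentzGain (G ∘ ‖·‖) v = 4π ∫ (J(t) - J(0)) dγ(t)`. [folklore] -/
theorem gainTerm_sub_lorentzGain_radial_eq (hG : Measurable G) (hm : ∀ t : ℝ, 0 ≤ t → |G t| ≤ m * (1 + t))
    (v : EuclideanSpace ℝ (Fin 3)) :
    gainTerm (fun x => G ‖x‖) v - lorentzGain (fun x => G ‖x‖) v =
      4 * π * ∫ t, ((∫ x in (-1:ℝ)..1, max (‖v‖ * x - t) 0 * G (√(‖v‖ ^ 2 - (‖v‖ * x) ^ 2 + t ^ 2))) -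
        ∫ x in (-1:ℝ)..1, max (‖v‖ * x) 0 * G (√(‖v‖ ^ 2 - (‖v‖ * x) ^ 2))) ∂gaussianReal 0 1 := by
  rw [gainTerm_radial_eq_slice hG hm v, lorentzGain_radial_eq_slice hG v,
    integral_sub (integrable_slice hG hm v) (integrable_const _), integral_const, probReal_univ, one_smul]
  ring

/-! ### Registered helper -/

/-- **Registered helper `t12_gainTerm_radial_slice` — the exact one-dimensional (Carleman slice)
representation of the true gain term on a general radial test function.** For `G : ℝ → ℝ` measurable
with `|G t| ≤ m (1 + t)` for `t ≥ 0` and every `v ∈ ℝ³` (`M = stdGaussian`, `σ` the surface measure of `S²`,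
`(v', w') = collide ω (v, w)`, `γ = gaussianReal 0 1`, `S = ‖v‖`):
`∫ dM(w) ∫_{S²} ((v-w)·ω)₊ G(‖v'‖) dσ(ω) + ∫ dM(w) ∫_{S²} ((v-w)·ω)₊ G(‖w'‖) dσ(ω)`
`= 4π ∫ γ(dt) ∫_{-1}^{1} (S x - t)₊ G(√(S² - (S x)² + t²)) dx`,
i.e. `gainTerm (G ∘ ‖·‖) v = 4π ∫ J(t) dγ(t)` with the radial slice `J(t)`. Mechanism: by the exchange symmetry
(`gainFst_eq_gainSnd`) the gain term is twice its own piece; with `a = ⟪v, ω⟫`, `t = ⟪w, ω⟫` the own particle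
has flux `(a - t)₊` and speed `‖v'‖ = √(S² - a² + t²)` (Carleman's slice), the projection `t` of the
Maxwellian partner is a standard real Gaussian for every `ω`, and `a = S x` with `x` uniform on `[-1, 1]`
(hat-box, weight `2π`). The Lorentz operator is the slice `t = 0`: `lorentzGain (G ∘ ‖·‖) v = 4π J(0)`
(`lorentzGain_radial_eq_slice`), so (e-K₂) for rough radial `G` is the one-dimensional law comparison
`∫ γ(dt) (J(t) - J(0))` (`gainTerm_sub_lorentzGain_radial_eq`; estimate in `…T12GainRadialGeneralB`). [folklore] -/
theorem t12_gainTerm_radial_slice : ∀ (G : ℝ → ℝ) (m : ℝ), Measurable G → (∀ t : ℝ, 0 ≤ t → |G t| ≤ m * (1 + t)) → ∀ v : EuclideanSpace ℝ (Fin 3), (∫ w, ∫ ω, Literature.MathematicalPhysics.KineticTheory.hardSphereKernel (v, w) ω * G ‖(Literature.MathematicalPhysics.KineticTheory.collide ω (v, w)).1‖ ∂Literature.MathematicalPhysics.KineticTheory.sphereMeasure ∂ProbabilityTheory.stdGaussian (EuclideanSpace ℝ (Fin 3))) + (∫ w, ∫ ω, Literature.MathematicalPhysics.KineticTheory.hardSphereKernel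 (v, w) ω * G ‖(Literature.MathematicalPhysics.KineticTheory.collide ω (v, w)).2‖ ∂Literature.MathematicalPhysics.KineticTheory.sphereMeasure ∂ProbabilityTheory.stdGaussian (EuclideanSpace ℝ (Fin 3))) = 4 * Real.pi * ∫ t, (∫ x in (-1:ℝ)..1, max (‖v‖ * x - t) 0 * G (Real.sqrt (‖v‖ ^ 2 - (‖v‖ * x) ^ 2 + t ^ 2))) ∂ProbabilityTheory.gaussianReal 0 1 :=
  fun _ _ hG hm v => gainTerm_radial_eq_slice hG hm v

end Summit.AtomisticToContinuum.HydrodynamicLimit.Theorems.ClampedCorrectorBirth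

end
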